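import Literature.RepresentationTheory.FiniteGroups.GL2ModularPrincipalSeriesReduction
import Literature.RepresentationTheory.FiniteGroups.GL2ModularPrincipalSeriesSocle
import Literature.NumberTheory.EllipticCurves.Kato2004.SemilocalDecompositionProofs
import HarnessLib

/-!
# Teichmüller-power types: the character hypotheses of the lattice theorem for `χ₁ = ω̃ⁱ`, `χ₂ = ω̃ʲ`

Topic `Literature/RepresentationTheory/FiniteGroups`, namespace `Literature.RepresentationTheory.FiniteGroups.GL2`.
THEOREMS ONLY; no named fact, no instance, no notation, no `sorry`.

The tame principal-series types occurring for elliptic curves with potentially good ordinary reduction are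
`Ind(ω̃ᵇ ⊗ ω̃⁻ᵇ)` with `ω̃ : 𝔽_pˣ → ℤ_pˣ` the Teichmüller character [EmertonGeeSavitt2015, §3.2 (the types `σ(χ)`,
`χ = η ⊗ η'` tame)]; the tree's Teichmüller character is `Literature.NumberTheory.EllipticCurves.Kato2004.teichmullerChar p`
(`toZMod_teichmullerChar : ω̃(a) ≡ a`).  For the lattice theorem
(`GL2ModularPrincipalSeriesLatticeUnique*`) one needs, for `χ₁ = ω̃ⁱ`, `χ₂ = ω̃ʲ` and a residue algebra
`ℤ_p → k` factoring through `toZMod` (hypothesis `halg`; e.g. `k = ZMod p` with `(PadicInt.toZMod).toAlgebra`), the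
reductions `χ̄₁ = εⁱ`, `χ̄₂ = εʲ` (`ε = ZMod.castHom _ k` on units), the relation `χ̄₂ = χ̄₁ · εʳ` for `j = i + r`,
and `χ̄₁ ≠ χ̄₂` for `0 < r < p − 1`:

* `coe_reduceChar_teichmullerChar_pow` — `χ̄ (ω̃ⁱ) (a) = ε(a)ⁱ`;
* `reduceChar_teichmullerChar_pow_rel` — the hypothesis `hχ` of the lattice/socle theorems for `(ω̃ⁱ, ω̃ⁱ⁺ʳ)`;
* `reduceChar_teichmullerChar_pow_eq_mul` / `reduceChar_teichmullerChar_pow_ne` — `χ̄₂ = χ̄₁ εʳ` as characters and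
  the hypothesis `hχne` for `0 < r < p − 1` (from the tree's `ne_mul_pow_unitsMap_castHom`).
-/

noncomputable section

namespace Literature.RepresentationTheory.FiniteGroups

namespace GL2

open Function
open Literature.NumberTheory.EllipticCurves (Kato2004.teichmullerChar Kato2004.toZMod_teichmullerChar)

section Teichmuller

variable (p : ℕ) [Fact p.Prime] {k : Type} [CommRing k] [CharP k p] [Algebra ℤ_[p] k]

/-- **Reduction of a Teichmüller power**: `(ℤ_p → k)(ω̃(a)ⁱ) = ε(a)ⁱ` when the residue algebra `ℤ_p → k` factors
through `toZMod`. [cite: EmertonGeeSavitt2015, §3.2] -/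
theorem coe_reduceChar_teichmullerChar_pow
    (halg : ∀ x : ℤ_[p], algebraMap ℤ_[p] k x = ZMod.castHom (dvd_refl p) k (PadicInt.toZMod x)) (i : ℕ)
    (a : (ZMod p)ˣ) :
    (reduceChar k (Kato2004.teichmullerChar p ^ i) a : k) = ZMod.castHom (dvd_refl p) k a ^ i := by
  rw [coe_reduceChar_apply, MonoidHom.pow_apply, Units.val_pow_eq_pow_val, map_pow, halg,
    Kato2004.toZMod_teichmullerChar]

/-- **The hypothesis `hχ`** of the socle / lattice theorems for the Teichmüller-power type `(ω̃ⁱ, ω̃ʲ)`, `j = i + r`: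
`χ̄₂(a) = χ̄₁(a) · ε(a)ʳ`. [cite: EmertonGeeSavitt2015, §3.2] -/
theorem reduceChar_teichmullerChar_pow_rel
    (halg : ∀ x : ℤ_[p], algebraMap ℤ_[p] k x = ZMod.castHom (dvd_refl p) k (PadicInt.toZMod x)) {i j r : ℕ}
    (h : j = i + r) (a : (ZMod p)ˣ) :
    (reduceChar k (Kato2004.teichmullerChar p ^ j) a : k) =
      (reduceChar k (Kato2004.teichmullerChar p ^ i) a : k) * ZMod.castHom (dvd_refl p) k a ^ r := by
  rw [coe_reduceChar_teichmullerChar_pow p halg, coe_reduceChar_teichmullerChar_pow p halg, h, pow_add]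

/-- `χ̄₂ = χ̄₁ · εʳ` as characters `𝔽_pˣ → kˣ` (`χ₁ = ω̃ⁱ`, `χ₂ = ω̃ⁱ⁺ʳ`). [cite: EmertonGeeSavitt2015, §3.2] -/
theorem reduceChar_teichmullerChar_pow_eq_mul
    (halg : ∀ x : ℤ_[p], algebraMap ℤ_[p] k x = ZMod.castHom (dvd_refl p) k (PadicInt.toZMod x)) {i j r : ℕ}
    (h : j = i + r) :
    reduceChar k (Kato2004.teichmullerChar p ^ j) =
      reduceChar k (Kato2004.teichmullerChar p ^ i) * Units.map ((ZMod.castHom (dvd_refl p) k).toMonoidHom) ^ r := by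
  ext a
  rw [reduceChar_teichmullerChar_pow_rel p halg h, MonoidHom.mul_apply, Units.val_mul, MonoidHom.pow_apply,
    Units.val_pow_eq_pow_val]
  rfl

/-- **The hypothesis `hχne`** for the Teichmüller-power type over a FIELD `k` of characteristic `p`: for
`0 < r < p − 1`, `χ̄(ω̃ⁱ) ≠ χ̄(ω̃ⁱ⁺ʳ)` (`ε` has order `p − 1`). [cite: EmertonGeeSavitt2015, §3.2] -/
theorem reduceChar_teichmullerChar_pow_ne {k : Type} [Field k] [CharP k p] [Algebra ℤ_[p] k]
    (halg : ∀ x : ℤ_[p], algebraMap ℤ_[p] k x = ZMod.castHom (dvd_refl p) k (PadicInt.toZMod x)) {i j r : ℕ}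
    (h : j = i + r) (h0 : 0 < r) (hr : r < p - 1) :
    reduceChar k (Kato2004.teichmullerChar p ^ i) ≠ reduceChar k (Kato2004.teichmullerChar p ^ j) := by
  have hrel : reduceChar k (Kato2004.teichmullerChar p ^ j) =
      reduceChar k (Kato2004.teichmullerChar p ^ i) * Units.map ((ZMod.castHom (dvd_refl p) k).toMonoidHom) ^ r := by
    ext a
    rw [MonoidHom.mul_apply, Units.val_mul, MonoidHom.pow_apply, Units.val_pow_eq_pow_val, coe_reduceChar_apply,
      coe_reduceChar_apply, MonoidHom.pow_apply, MonoidHom.pow_apply, Units.val_pow_eq_pow_val,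
      Units.val_pow_eq_pow_val, map_pow, map_pow, halg, Kato2004.toZMod_teichmullerChar, h, pow_add]
    rfl
  rw [hrel]
  exact ne_mul_pow_unitsMap_castHom p _ h0 hr

end Teichmuller

end GL2

end Literature.RepresentationTheory.FiniteGroups
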